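import Mathlib.Probability.Distributions.Gaussian.Fernique
import Mathlib.MeasureTheory.Integral.DominatedConvergence
import HarnessLib

/-!
# Exponential moments of the norm under a Gaussian measure

Topic `Literature/Probability/Moments`.  For a Gaussian measure `μ` on a separable Banach space
(`ProbabilityTheory.IsGaussian`), Fernique's theorem (`IsGaussian.exists_integrable_exp_sq`:
`exp(C‖x‖²)` is integrable for some `C > 0`; X. Fernique, C. R. Acad. Sci. Paris 270 (1970)) gives at
once that ALL exponential moments of the norm are finite, `∫ exp(c‖x‖) dμ < ∞`
(`integrable_exp_mul_norm_of_isGaussian`, since `c‖x‖ ≤ c²/(4C) + C‖x‖²`), and hence, by dominated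
convergence, that the exponential moment `t ↦ ∫ exp(t‖x‖) dμ` is continuous
(`continuous_integral_exp_mul_norm_of_isGaussian`) and in particular tends to `1` as `t → 0`:
for every `η > 0` there is `t₀ > 0` with `∫⁻ exp(t‖x‖) dμ ≤ exp η` for `0 ≤ t ≤ t₀`
(`exists_lintegral_exp_mul_norm_le_of_isGaussian`, in the `∫⁻ … ENNReal.ofReal (Real.exp …)`
currency of large-deviation statements).  This is the one-site input "`log E exp(t‖v‖) → 0` as the
coupling `t → 0`" of window-pressure estimates for Maxwellian velocities (e.g. streaming terms
`t ∑ᵢ ‖vᵢ‖` with `t` proportional to a vanishing mesh).  No new definitions.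

## Mathlib reuse

`ProbabilityTheory.IsGaussian.exists_integrable_exp_sq` (Fernique), `MeasureTheory.continuous_of_dominated`,
`MeasureTheory.ofReal_integral_eq_lintegral_ofReal`, `Metric.eventually_nhds_iff`.

## References

* X. Fernique, *Intégrabilité des vecteurs gaussiens*, C. R. Acad. Sci. Paris Sér. A 270 (1970)
  1698–1699 (via Mathlib's `Mathlib.Probability.Distributions.Gaussian.Fernique`). [folklore]
-/

noncomputable section

namespace Literature.Probability.Moments

open _root_.MeasureTheory _root_.ProbabilityTheory Set Filter
open scoped ENNReal Topology

variable {E : Type*} [NormedAddCommGroup E] [NormedSpace ℝ E] [MeasurableSpace E] [BorelSpace E]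
  [SecondCountableTopology E] [CompleteSpace E]

/-- **All exponential moments of the norm are finite under a Gaussian measure**:
`Integrable (fun x => exp (c * ‖x‖)) μ` for every real `c` (Fernique: `exp(C‖x‖²)` is integrable for
some `C > 0`, and `c‖x‖ ≤ c²/(4C) + C‖x‖²`). [folklore] -/
theorem integrable_exp_mul_norm_of_isGaussian (μ : Measure E) [IsGaussian μ] (c : ℝ) :
    Integrable (fun x => Real.exp (c * ‖x‖)) μ := by
  obtain ⟨C, hC, hint⟩ := IsGaussian.exists_integrable_exp_sq μ
  have hmeas : AEStronglyMeasurable (fun x : E => Real.exp (c * ‖x‖)) μ :=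
    (Real.continuous_exp.comp (continuous_const.mul continuous_norm)).aestronglyMeasurable
  refine (hint.const_mul (Real.exp (c ^ 2 / (4 * C)))).mono' hmeas (ae_of_all _ fun x => ?_)
  rw [Real.norm_eq_abs, abs_of_pos (Real.exp_pos _), ← Real.exp_add]
  refine Real.exp_le_exp.2 ?_
  have h : 0 ≤ C * (‖x‖ - c / (2 * C)) ^ 2 := by positivity
  have h' : C * (‖x‖ - c / (2 * C)) ^ 2 = C * ‖x‖ ^ 2 - c * ‖x‖ + c ^ 2 / (4 * C) := by
    field_simp
    ring
  linarith

/-- **The exponential moment of the norm is continuous in the coupling** under a Gaussian measure: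
`t ↦ ∫ exp(t‖x‖) dμ` is continuous on `ℝ` (dominated convergence on every bounded range of `t`,
domination by the integrable `exp(T‖x‖)`). [folklore] -/
theorem continuous_integral_exp_mul_norm_of_isGaussian (μ : Measure E) [IsGaussian μ] :
    Continuous fun t : ℝ => ∫ x, Real.exp (t * ‖x‖) ∂μ := by
  -- continuity on each open interval `(-T, T)` suffices
  refine continuous_iff_continuousAt.2 fun t₀ => ?_
  set T : ℝ := |t₀| + 1 with hT
  have hT0 : |t₀| < T := by rw [hT]; linarith
  refine continuousAt_of_dominated (bound := fun x => Real.exp (T * ‖x‖)) ?_ ?_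
    (integrable_exp_mul_norm_of_isGaussian μ T) (ae_of_all _ fun x => ?_)
  · exact Eventually.of_forall fun t =>
      (Real.continuous_exp.comp (continuous_const.mul continuous_norm)).aestronglyMeasurable
  · have hev : ∀ᶠ t in 𝓝 t₀, |t| < T := by
      have hc : ContinuousAt (fun t : ℝ => |t|) t₀ := continuous_abs.continuousAt
      exact hc.eventually (Iio_mem_nhds hT0)
    filter_upwards [hev] with t ht
    refine ae_of_all _ fun x => ?_
    rw [Real.norm_eq_abs, abs_of_pos (Real.exp_pos _)]
    refine Real.exp_le_exp.2 (mul_le_mul_of_nonneg_right ?_ (norm_nonneg x))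
    exact (le_abs_self t).trans ht.le
  · exact ((continuous_id.mul continuous_const).rexp).continuousAt

/-- **Small couplings have exponential moment close to one** (`lintegral` currency): under a Gaussian
measure, for every `η > 0` there is `t₀ > 0` such that `∫⁻ exp(t‖x‖) dμ ≤ exp η` for all
`0 ≤ t ≤ t₀` (continuity at `t = 0`, where the moment is `1`). [folklore] -/
theorem exists_lintegral_exp_mul_norm_le_of_isGaussian (μ : Measure E) [IsGaussian μ] {η : ℝ}
    (hη : 0 < η) :
    ∃ t₀ : ℝ, 0 < t₀ ∧ ∀ t : ℝ, 0 ≤ t → t ≤ t₀ →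
      ∫⁻ x, ENNReal.ofReal (Real.exp (t * ‖x‖)) ∂μ ≤ ENNReal.ofReal (Real.exp η) := by
  have hcont := (continuous_integral_exp_mul_norm_of_isGaussian μ).continuousAt (x := (0 : ℝ))
  have h0 : ∫ x, Real.exp ((0 : ℝ) * ‖x‖) ∂μ = 1 := by simp
  have hlt : ∫ x, Real.exp ((0 : ℝ) * ‖x‖) ∂μ < Real.exp η := by
    rw [h0]
    exact Real.one_lt_exp_iff.2 hη
  have hev : ∀ᶠ t in 𝓝 (0 : ℝ), ∫ x, Real.exp (t * ‖x‖) ∂μ < Real.exp η :=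
    hcont.eventually (Iio_mem_nhds hlt)
  obtain ⟨r, hr, hball⟩ := Metric.eventually_nhds_iff.1 hev
  refine ⟨r / 2, half_pos hr, fun t ht0 htr => ?_⟩
  have hdist : dist t 0 < r := by
    rw [Real.dist_eq, sub_zero, abs_of_nonneg ht0]
    linarith
  have hint := integrable_exp_mul_norm_of_isGaussian μ t
  rw [← ofReal_integral_eq_lintegral_ofReal hint (ae_of_all _ fun x => (Real.exp_pos _).le)]
  exact ENNReal.ofReal_le_ofReal (hball hdist).le

end Literature.Probability.Moments

end
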